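import Summits.AtomisticToContinuum.HydrodynamicLimit.Theorems.TwoClocksClampedWindowDockEntropyProduction
import Summits.AtomisticToContinuum.HydrodynamicLimit.Theorems.OneFlightGossipEngineAssemblyEntropyProduction
import Summits.AtomisticToContinuum.HydrodynamicLimit.Theorems.CollisionIsometryCLTMacroClosureStubLedgerScaling
import Summits.AtomisticToContinuum.HydrodynamicLimit.Theorems.JParityClosureKineticEnergyTailsApriori
import Literature.Analysis.FluidPDE.CollisionalTransfer

/-!
# The one-window entropy balance identity (R1 of line `IdeatorOneSketch`, crux `HydroLimitInBand`, stmt-9133)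

Support file (`--supports stmt-AtomisticToContinuum-9133`) for the crux
`Summit.AtomisticToContinuum.HydrodynamicLimit.Theses.ImplosionDichotomy.HydroLimitInBand`, line
`IdeatorOneSketch`, registered stub `stub_windowEntropyBalance : WindowEntropyBalance`, landed UNFOLDED as
`windowEntropyBalance_identity` (statement = verbatim the body of the line's def `WindowEntropyBalance`).
Step (i) of the entropy clock as an EXACT finite-`N` identity over one window `[s, s + h]`: for hard spheres
on `𝕋³` at `0 < σ ≤ 1/2` started from `λ_N = localGibbsLaw σ a₀ u₀ θ₀ N Φ`, a smooth reference `ψ = (b, w, ϑ)`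
used on the window and a continuous reference `ψ′ = (b′, w′, ϑ′)` used from `s + h` on (`f_r = lawAt Φ λ_N r`),
`KL(f_{s+h} ‖ ψ′_N) − KL(f_s ‖ ψ_N) = − E_{f_s}[∫₀ʰ G′_ψ(Φ_r z) dr + W^mom_{w/ϑ}(z,h) + W^en_{−1/ϑ}(z,h)]`
`+ E_{f_{s+h}}[G_ψ − G_{ψ′}] + (log Z_pos(b′) − log Z_pos(b))`, where `G_ψ(z) = Σ_i g_ψ(z_i)`,
`g_ψ(x, v) = log b(x) − (3/2) log(2πϑ(x)) − |v − w(x)|²/(2ϑ(x))`, `G′_ψ` is its streaming derivative and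
`W^mom`, `W^en` are the collisional transfers along the flow. Ingredients, all in the tree: the production
identity `toReal_klDiv_lawAt_localGibbsLaw_sub` (time-`0` reference `λ_N` itself) with the explicit
log-densities `EntropyClockDock.ae_logRatio_eq_oneBody`, the weak balance laws of
`Literature.Analysis.FluidPDE.CollisionalTransfer`, the group law `Φ.flow_add` on the good set, energy
conservation `IsHardSphereTrajectory.configEnergy_eq_holds`, the Gaussian second moments of `λ_N`
(`lintegral_meanVelObs_localGibbsMeasure_le`) and the quadratic velocity growth of `log prof_ψ`
(`MacroClosureLine.StubLedger.integrable_logPair_comp`). §1 integrability; §2 the pathwise window balance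
`G_ψ(Φ_h z) − G_ψ(z) = ∫₀ʰ G′_ψ + W^mom + W^en`; §3 `KL(f_t ‖ ψ_N)` explicit; §4 the stub.
References: H.-T. Yau, Lett. Math. Phys. 22 (1991) §2; S. Olla, S. R. S. Varadhan, H.-T. Yau, Comm. Math.
Phys. 155 (1993) §3; H. Spohn, *Large Scale Dynamics of Interacting Particles* (1991), Part I §3.2.
prover-line-stmt-AtomisticToContinuum-9133-0.
-/

noncomputable section

open MeasureTheory Filter Set Topology InformationTheory
open scoped ENNReal InnerProductSpace

namespace Summit.AtomisticToContinuum.HydrodynamicLimit.Theorems.EntropyClockDock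

open Literature.MathematicalPhysics.KineticTheory Literature.Analysis.FluidPDE
open Literature.Analysis.FunctionSpaces
open MacroClosureLine.StubLedger (logPair_eq_sum kineticPair_eq_sum integrable_logPair_comp)

variable {σ : ℝ} {a₀ θ₀ : T3 → ℝ} {u₀ : T3 → V3}

/-! ### §1 The law lives on the good set; kinetic energy and one-body sums are integrable -/

/-- The local Gibbs law gives full mass to the good set (it is Liouville-absolutely continuous). [folklore] -/
theorem ae_mem_good_localGibbsLaw (σ : ℝ) (a₀ θ₀ : T3 → ℝ) (u₀ : T3 → V3) (N : ℕ)
    (Φ : HardSphereFlow (Torus.geometry (Fin 3)) (hsDiameter σ N) (N + 1)) :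
    ∀ᵐ z ∂(localGibbsLaw σ a₀ u₀ θ₀ N Φ), z ∈ Φ.good := by
  rw [localGibbsLaw_eq]
  exact (localGibbsMeasure_absolutelyContinuous σ a₀ u₀ θ₀ N Φ).ae_le Φ.ae_mem_good

/-- **The kinetic energy is integrable under the local Gibbs law**, `E_λ[Σ_i |v_i|²] < ∞`: given the positions
the velocities are Gaussian, `∫ |v|² dN(u, θ) = |u|² + 3θ` (`lintegral_meanVelObs_localGibbsMeasure_le`). [folklore] -/
theorem integrable_sum_norm_sq_localGibbsLaw (ha : Continuous a₀) (hθ : Continuous θ₀)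
    (hu : Continuous u₀) (ha0 : ∀ x, 0 ≤ a₀ x) (hθ0 : ∀ x, 0 < θ₀ x) (σ : ℝ) (N : ℕ)
    (Φ : HardSphereFlow (Torus.geometry (Fin 3)) (hsDiameter σ N) (N + 1)) :
    Integrable (fun z : Config (N + 1) (Fin 3) T3 => ∑ i, ‖(z i).2‖ ^ 2) (localGibbsLaw σ a₀ u₀ θ₀ N Φ) := by
  obtain ⟨U, -, hU⟩ := exists_forall_abs_le_of_continuous (χ := fun x => ‖u₀ x‖) hu.norm
  obtain ⟨Θ, -, hΘ⟩ := exists_forall_abs_le_of_continuous hθ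
  have hmean : Integrable (fun z : Config (N + 1) (Fin 3) T3 =>
      ((N : ℝ) + 1)⁻¹ * ∑ i, ‖(z i).2‖ ^ 2) (localGibbsLaw σ a₀ u₀ θ₀ N Φ) := by
    refine ⟨(by fun_prop : Measurable fun z : Config (N + 1) (Fin 3) T3 =>
      ((N : ℝ) + 1)⁻¹ * ∑ i, ‖(z i).2‖ ^ 2).aestronglyMeasurable, ?_⟩
    rw [hasFiniteIntegral_iff_ofReal (Eventually.of_forall fun z => by simp only [Pi.zero_apply]; positivity)]
    refine lt_of_le_of_lt (b := ENNReal.ofReal (U ^ 2 + 3 * Θ)) ?_ ENNReal.ofReal_lt_top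
    rw [localGibbsLaw_eq]
    refine lintegral_meanVelObs_localGibbsMeasure_le ha hθ hu ha0 hθ0 (f := fun v : V3 => ‖v‖ ^ 2)
      (by fun_prop) (fun v => sq_nonneg _) (fun y => ?_) σ N
    rw [lintegral_norm_sq_gaussMeasure (u₀ y) (hθ0 y)]
    have h1 : ‖u₀ y‖ ≤ U := by simpa only [abs_of_nonneg (norm_nonneg _)] using hU y
    exact ENNReal.ofReal_le_ofReal (by
      linarith [(le_abs_self _).trans (hΘ y), pow_le_pow_left₀ (norm_nonneg _) h1 2])
  refine (hmean.const_mul ((N : ℝ) + 1)).congr (Eventually.of_forall fun z => ?_)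
  simp only
  rw [← mul_assoc, mul_inv_cancel₀ (by positivity), one_mul]

/-- **Along the flow the kinetic energy stays integrable**: it is conserved on the good set
(`IsHardSphereTrajectory.configEnergy_eq_holds`), which carries the law. [folklore] -/
theorem integrable_sum_norm_sq_flow (ha : Continuous a₀) (hθ : Continuous θ₀) (hu : Continuous u₀)
    (ha0 : ∀ x, 0 ≤ a₀ x) (hθ0 : ∀ x, 0 < θ₀ x) (σ : ℝ) (N : ℕ)
    (Φ : HardSphereFlow (Torus.geometry (Fin 3)) (hsDiameter σ N) (N + 1)) (t : ℝ) :
    Integrable (fun z : Config (N + 1) (Fin 3) T3 => ∑ i, ‖(Φ.flow t z i).2‖ ^ 2) (localGibbsLaw σ a₀ u₀ θ₀ N Φ) := by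
  refine (integrable_sum_norm_sq_localGibbsLaw ha hθ hu ha0 hθ0 σ N Φ).congr ?_
  filter_upwards [ae_mem_good_localGibbsLaw σ a₀ θ₀ u₀ N Φ] with z hz
  have hE := IsHardSphereTrajectory.configEnergy_eq_holds (Φ.isTrajectory z hz) t 0
  rw [Φ.flow_zero z hz] at hE
  have h2 : (2 : ℝ) * configEnergy z = 2 * configEnergy (Φ.flow t z) := by rw [hE]
  simpa [configEnergy] using h2

/-- The one-body sum `z ↦ Σ_i g_ψ(z_i)` is measurable (continuous profiles). [folklore] -/
theorem measurable_oneBodySum {n : ℕ} {b ϑ : T3 → ℝ} {w : T3 → V3} (hb : Continuous b)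
    (hϑ : Continuous ϑ) (hw : Continuous w) :
    Measurable fun z : Config n (Fin 3) T3 => ∑ i, (Real.log (b (z i).1) - 3 / 2 * Real.log (2 * Real.pi * ϑ (z i).1) -
      ‖(z i).2 - w (z i).1‖ ^ 2 / (2 * ϑ (z i).1)) := by
  have := hb.measurable; have := hϑ.measurable; have := hw.measurable
  fun_prop

/-- **One-body sums are integrable along the flow**: `g_ψ = log prof_ψ` has quadratic velocity growth
(`MacroClosureLine.StubLedger.integrable_logPair_comp`), and `integrable_sum_norm_sq_flow`. [folklore] -/
theorem integrable_oneBodySum_flow (hσ2 : σ ≤ 1 / 2) (ha : Continuous a₀) (hθ : Continuous θ₀)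
    (hu : Continuous u₀) (ha0 : ∀ x, 0 < a₀ x) (hθ0 : ∀ x, 0 < θ₀ x) {b ϑ : T3 → ℝ} {w : T3 → V3}
    (hb : Continuous b) (hϑ : Continuous ϑ) (hw : Continuous w) (hb0 : ∀ x, 0 < b x)
    (hϑ0 : ∀ x, 0 < ϑ x) (N : ℕ) (Φ : HardSphereFlow (Torus.geometry (Fin 3)) (hsDiameter σ N) (N + 1)) (t : ℝ) :
    Integrable (fun z : Config (N + 1) (Fin 3) T3 => ∑ i, (Real.log (b (Φ.flow t z i).1) -
        3 / 2 * Real.log (2 * Real.pi * ϑ (Φ.flow t z i).1) -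
        ‖(Φ.flow t z i).2 - w (Φ.flow t z i).1‖ ^ 2 / (2 * ϑ (Φ.flow t z i).1)))
      (localGibbsLaw σ a₀ u₀ θ₀ N Φ) := by
  haveI := isProbabilityMeasure_localGibbsLaw ha hθ hu ha0 hθ0 hσ2 N Φ
  -- domination by the kinetic energy (`integrable_logPair_comp`), which stays integrable along the flow
  have hK : Integrable (fun z => ∫ y, ‖y.2‖ ^ 2 ∂(empiricalMeasure (Φ.flow t z)))
      (localGibbsLaw σ a₀ u₀ θ₀ N Φ) := by
    simp_rw [kineticPair_eq_sum]
    exact (integrable_sum_norm_sq_flow ha hθ hu (fun x => (ha0 x).le) hθ0 σ N Φ t).const_mul _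
  refine ((integrable_logPair_comp hb hϑ hw hb0 hϑ0 (Φ.measurable_flow t) hK).const_mul
    ((N : ℝ) + 1)).congr (ae_of_all _ fun z => ?_)
  simp only
  rw [logPair_eq_sum, ← mul_assoc, mul_inv_cancel₀ (by positivity), one_mul]
  exact Finset.sum_congr rfl fun i _ => log_localGibbsProfile (hb0 _) (hϑ0 _) _

/-- The flow-free case: `z ↦ Σ_i g_ψ(z_i)` is `λ_N`-integrable (`Φ_0 = id` almost surely). [folklore] -/
theorem integrable_oneBodySum (hσ2 : σ ≤ 1 / 2) (ha : Continuous a₀) (hθ : Continuous θ₀)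
    (hu : Continuous u₀) (ha0 : ∀ x, 0 < a₀ x) (hθ0 : ∀ x, 0 < θ₀ x) {b ϑ : T3 → ℝ} {w : T3 → V3}
    (hb : Continuous b) (hϑ : Continuous ϑ) (hw : Continuous w) (hb0 : ∀ x, 0 < b x)
    (hϑ0 : ∀ x, 0 < ϑ x) (N : ℕ) (Φ : HardSphereFlow (Torus.geometry (Fin 3)) (hsDiameter σ N) (N + 1)) :
    Integrable (fun z : Config (N + 1) (Fin 3) T3 => ∑ i, (Real.log (b (z i).1) -
        3 / 2 * Real.log (2 * Real.pi * ϑ (z i).1) - ‖(z i).2 - w (z i).1‖ ^ 2 / (2 * ϑ (z i).1)))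
      (localGibbsLaw σ a₀ u₀ θ₀ N Φ) := by
  refine (integrable_oneBodySum_flow hσ2 ha hθ hu ha0 hθ0 hb hϑ hw hb0 hϑ0 N Φ 0).congr ?_
  filter_upwards [ae_mem_good_localGibbsLaw σ a₀ θ₀ u₀ N Φ] with z hz
  rw [Φ.flow_zero z hz]

/-! ### §2 The pathwise window balance of `G_ψ` -/

/-- **The one-body exponent splits into a position, a momentum and an energy part**:
`g_ψ(x, v) = λ₀(x) + ⟪w(x)/ϑ(x), v⟫ − |v|²/(2ϑ(x))` with `λ₀ = log b − (3/2) log(2πϑ) − |w|²/(2ϑ)`; summed,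
`G_ψ = Σ_i λ₀(x_i) + momentumObservable (ϑ⁻¹ • w) + energyObservable (−ϑ⁻¹)`. [folklore] -/
theorem oneBodySum_eq_add {n : ℕ} (b ϑ : T3 → ℝ) (w : T3 → V3) (z : Config n (Fin 3) T3) :
    ∑ i, (Real.log (b (z i).1) - 3 / 2 * Real.log (2 * Real.pi * ϑ (z i).1) -
        ‖(z i).2 - w (z i).1‖ ^ 2 / (2 * ϑ (z i).1)) =
      (∑ i, (Real.log (b (z i).1) - 3 / 2 * Real.log (2 * Real.pi * ϑ (z i).1) -
          ‖w (z i).1‖ ^ 2 / (2 * ϑ (z i).1))) +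
        momentumObservable (fun x => (ϑ x)⁻¹ • w x) z + energyObservable (fun x => -(ϑ x)⁻¹) z := by
  simp only [momentumObservable, energyObservable, ← Finset.sum_add_distrib]
  refine Finset.sum_congr rfl fun i _ => ?_
  rw [norm_sub_sq_real, real_inner_smul_left, real_inner_comm (w (z i).1) ((z i).2)]
  ring

/-- Translations of the flat torus `𝕋³` are continuous. [folklore] -/
private theorem torus3_continuous_translate (x : T3) :
    Continuous ((Torus.geometry (Fin 3)).translate x) :=
  continuous_const.add Torus.continuous_proj

/-- **Weak balance law for a position observable along the flow** (as in
`Theorems/AnnealedZeroHorizonMassContinuity.lean`): for `C¹` `ψ : 𝕋³ → ℝ`, good `z` and `h ≥ 0`,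
`Σ_k ψ(x_k(h)) − Σ_k ψ(x_k(0)) = ∫₀ʰ Σ_k Dψ(x_k(s)) v_k(s) ds` with an integrable streaming term: positions
do not jump (`IsHardSphereTrajectory.leftLim_apply_fst`), so the collisional transfer of `z ↦ Σ_k ψ(x_k)`
vanishes in `HardSphereFlow.sub_eq_integral_add_collisionalTransfer`. [folklore] -/
theorem posSum_flow_sub_eq_integral {ε : ℝ} {n : ℕ}
    (Φ : HardSphereFlow (Torus.geometry (Fin 3)) ε n) {ψ : T3 → ℝ} (hψ : Torus.IsContDiff 1 ψ)
    {z : Config n (Fin 3) T3} (hz : z ∈ Φ.good) {h : ℝ} (hh : 0 ≤ h) :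
    IntervalIntegrable (fun s => ∑ k, Torus.fderiv ψ (Φ.flow s z k).1 (Φ.flow s z k).2) volume 0 h ∧
      ∑ k, ψ (Φ.flow h z k).1 - ∑ k, ψ (z k).1 =
        ∫ s in (0 : ℝ)..h, ∑ k, Torus.fderiv ψ (Φ.flow s z k).1 (Φ.flow s z k).2 := by
  have hF : ∀ (y : Config n (Fin 3) T3) (t : ℝ),
      HasDerivAt (fun s : ℝ => ∑ k, ψ (freeFlight (Torus.geometry (Fin 3)) s y k).1)
        (∑ k, Torus.fderiv ψ (freeFlight (Torus.geometry (Fin 3)) t y k).1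
          (freeFlight (Torus.geometry (Fin 3)) t y k).2) t := fun y t => by
    simp only [freeFlight_apply, Torus.geometry_translate]
    exact HasDerivAt.fun_sum fun k _ => Torus.hasDerivAt_apply_add_proj_smul hψ (y k).1 (y k).2 t
  have hF' : Continuous fun y : Config n (Fin 3) T3 => ∑ k, Torus.fderiv ψ (y k).1 (y k).2 :=
    continuous_finsetSum _ fun k _ =>
      ((Torus.continuous_fderiv hψ).comp (by fun_prop)).clm_apply (by fun_prop)
  have H := Φ.sub_eq_integral_add_collisionalTransfer torus3_continuous_translate
    (F := fun y : Config n (Fin 3) T3 => ∑ k, ψ (y k).1)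
    (F' := fun y : Config n (Fin 3) T3 => ∑ k, Torus.fderiv ψ (y k).1 (y k).2) hF
    (fun y => hF'.comp (continuous_freeFlight_of_continuous_translate torus3_continuous_translate y))
    hz hh
  -- positions do not jump: the collisional transfer of the position observable vanishes
  have h0 : Φ.collisionalTransfer (fun y : Config n (Fin 3) T3 => ∑ k, ψ (y k).1) z h = 0 := by
    simp only [HardSphereFlow.collisionalTransfer_eq, collisionalTransfer_def, collisionJump,
      (Φ.isTrajectory z hz).leftLim_apply_fst torus3_continuous_translate, sub_self, finsum_zero]
  rwa [h0, add_zero] at H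

/-- **The pathwise one-window balance of `G_ψ`.** For SMOOTH profiles `b, ϑ > 0`, `w`, a good datum `z`
and `h ≥ 0`: `G_ψ(Φ_h z) − G_ψ(z) = ∫₀ʰ G′_ψ(Φ_r z) dr + W^mom_{w/ϑ}(z, h) + W^en_{−1/ϑ}(z, h)` with the
streaming derivative `G′_ψ = Σ_i Dλ₀(x_i) v_i + momentumStreaming (ϑ⁻¹ • w) + energyStreaming (−ϑ⁻¹)`:
the three weak balance laws (`posSum_flow_sub_eq_integral`,
`HardSphereFlow.momentumObservable_sub_eq_torus`, `HardSphereFlow.energyObservable_sub_eq_torus`) summed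
through `oneBodySum_eq_add`. [folklore] -/
theorem oneBodySum_flow_sub_eq {ε : ℝ} {n : ℕ} (Φ : HardSphereFlow (Torus.geometry (Fin 3)) ε n)
    {b ϑ : T3 → ℝ} {w : T3 → V3} (hb : Torus.IsSmooth b) (hϑ : Torus.IsSmooth ϑ)
    (hw : Torus.IsSmooth w) (hb0 : ∀ x, 0 < b x) (hϑ0 : ∀ x, 0 < ϑ x) {z : Config n (Fin 3) T3}
    (hz : z ∈ Φ.good) {h : ℝ} (hh : 0 ≤ h) :
    (∑ i, (Real.log (b (Φ.flow h z i).1) - 3 / 2 * Real.log (2 * Real.pi * ϑ (Φ.flow h z i).1) -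
        ‖(Φ.flow h z i).2 - w (Φ.flow h z i).1‖ ^ 2 / (2 * ϑ (Φ.flow h z i).1))) -
      ∑ i, (Real.log (b (z i).1) - 3 / 2 * Real.log (2 * Real.pi * ϑ (z i).1) -
        ‖(z i).2 - w (z i).1‖ ^ 2 / (2 * ϑ (z i).1)) =
      (∫ r in (0 : ℝ)..h,
          ((∑ i, Torus.fderiv
              (fun x => Real.log (b x) - 3 / 2 * Real.log (2 * Real.pi * ϑ x) - ‖w x‖ ^ 2 / (2 * ϑ x))
              ((Φ.flow r z i).1) ((Φ.flow r z i).2)) +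
            momentumStreaming (fun x => (ϑ x)⁻¹ • w x) (Φ.flow r z) +
            energyStreaming (fun x => -(ϑ x)⁻¹) (Φ.flow r z))) +
        Φ.momentumTransfer (fun x => (ϑ x)⁻¹ • w x) z h +
        Φ.energyTransfer (fun x => -(ϑ x)⁻¹) z h := by
  -- `C¹` regularity of the three test fields, through their lifts to `ℝ³`
  obtain ⟨hb1, hϑ1, hw1⟩ : ContDiff ℝ 1 (Torus.lift b) ∧ ContDiff ℝ 1 (Torus.lift ϑ) ∧
      ContDiff ℝ 1 (Torus.lift w) := ⟨hb.isContDiff (by simp), hϑ.isContDiff (by simp), hw.isContDiff (by simp)⟩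
  have hϑne : ∀ y, Torus.lift ϑ y ≠ 0 := fun y => (hϑ0 _).ne'
  have hl : Torus.IsContDiff 1
      (fun x => Real.log (b x) - 3 / 2 * Real.log (2 * Real.pi * ϑ x) - ‖w x‖ ^ 2 / (2 * ϑ x)) :=
    ((hb1.log fun y => (hb0 _).ne').sub (contDiff_const.mul ((contDiff_const.mul hϑ1).log
      fun y => mul_ne_zero (mul_ne_zero two_ne_zero Real.pi_pos.ne') (hϑne y)))).sub
      ((hw1.norm_sq (𝕜 := ℝ)).div (contDiff_const.mul hϑ1) fun y => mul_ne_zero two_ne_zero (hϑne y))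
  have hJ : Torus.IsContDiff 1 (fun x => (ϑ x)⁻¹ • w x) := (hϑ1.inv hϑne).smul hw1
  have hn : Torus.IsContDiff 1 (fun x => -(ϑ x)⁻¹) := (hϑ1.inv hϑne).neg
  obtain ⟨hiD, hD⟩ := posSum_flow_sub_eq_integral Φ hl hz hh
  obtain ⟨hiM, hM⟩ := Φ.momentumObservable_sub_eq_torus hJ hz hh
  obtain ⟨hiE, hE⟩ := Φ.energyObservable_sub_eq_torus hn hz hh
  rw [intervalIntegral.integral_add (hiD.add hiM) hiE, intervalIntegral.integral_add hiD hiM,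
    oneBodySum_eq_add b ϑ w (Φ.flow h z), oneBodySum_eq_add b ϑ w z]
  linarith

/-! ### §3 The relative entropy at time `t` as an explicit expectation under `λ_N` -/

/-- **`KL(f_t ‖ ψ_N)` made explicit.** For `σ ≤ 1/2`, continuous positive profiles `(a₀, u₀, θ₀)` of `λ_N`
and a continuous positive reference `ψ = (b, w, ϑ)`:
`KL(lawAt Φ λ_N t ‖ ψ_N) = E_{λ_N}[G_λ(z) − G_ψ(Φ_t z)] + (log Z_pos(b) − log Z_pos(a₀))` — the production identity
`toReal_klDiv_lawAt_localGibbsLaw_sub` with the time-`0` reference `λ_N` itself (`KL(λ ‖ λ) = 0`), the explicit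
log-densities `ae_logRatio_eq_oneBody`, and the integrability of §1. [cite: Yau1991, §2] -/
theorem toReal_klDiv_lawAt_eq_integral (hσ2 : σ ≤ 1 / 2) (ha : Continuous a₀) (hθ : Continuous θ₀)
    (hu : Continuous u₀) (ha0 : ∀ x, 0 < a₀ x) (hθ0 : ∀ x, 0 < θ₀ x) {b ϑ : T3 → ℝ} {w : T3 → V3}
    (hb : Continuous b) (hϑ : Continuous ϑ) (hw : Continuous w) (hb0 : ∀ x, 0 < b x)
    (hϑ0 : ∀ x, 0 < ϑ x) (N : ℕ) (Φ : HardSphereFlow (Torus.geometry (Fin 3)) (hsDiameter σ N) (N + 1)) (t : ℝ) :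
    (klDiv (Φ.lawAt (localGibbsLaw σ a₀ u₀ θ₀ N Φ) t) (localGibbsLaw σ b w ϑ N Φ)).toReal =
      (∫ z, ((∑ i, (Real.log (a₀ (z i).1) - 3 / 2 * Real.log (2 * Real.pi * θ₀ (z i).1) -
            ‖(z i).2 - u₀ (z i).1‖ ^ 2 / (2 * θ₀ (z i).1))) -
          ∑ i, (Real.log (b (Φ.flow t z i).1) - 3 / 2 * Real.log (2 * Real.pi * ϑ (Φ.flow t z i).1) -
            ‖(Φ.flow t z i).2 - w (Φ.flow t z i).1‖ ^ 2 / (2 * ϑ (Φ.flow t z i).1)))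
        ∂(localGibbsLaw σ a₀ u₀ θ₀ N Φ)) +
      (Real.log (posPartition b (hsDiameter σ N) (N + 1)) -
        Real.log (posPartition a₀ (hsDiameter σ N) (N + 1))) := by
  haveI := isProbabilityMeasure_localGibbsLaw ha hθ hu ha0 hθ0 hσ2 N Φ
  have hsum : Integrable (fun z : Config (N + 1) (Fin 3) T3 =>
      (∑ i, (Real.log (a₀ (z i).1) - 3 / 2 * Real.log (2 * Real.pi * θ₀ (z i).1) -
          ‖(z i).2 - u₀ (z i).1‖ ^ 2 / (2 * θ₀ (z i).1))) -
        ∑ i, (Real.log (b (Φ.flow t z i).1) - 3 / 2 * Real.log (2 * Real.pi * ϑ (Φ.flow t z i).1) -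
          ‖(Φ.flow t z i).2 - w (Φ.flow t z i).1‖ ^ 2 / (2 * ϑ (Φ.flow t z i).1)))
      (localGibbsLaw σ a₀ u₀ θ₀ N Φ) :=
    (integrable_oneBodySum hσ2 ha hθ hu ha0 hθ0 ha hθ hu ha0 hθ0 N Φ).sub
      (integrable_oneBodySum_flow hσ2 ha hθ hu ha0 hθ0 hb hϑ hw hb0 hϑ0 N Φ t)
  have hae := ae_logRatio_eq_oneBody hσ2 a₀ θ₀ u₀ ha hθ hu ha0 hθ0 hb hϑ hw hb0 hϑ0 N Φ t
  -- the production identity with time-`0` reference `λ_N` itself (its log-ratio vanishes identically)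
  have key := toReal_klDiv_lawAt_localGibbsLaw_sub hσ2 ha hθ hu ha0 hθ0 ha hθ hu ha0 hθ0 hb hϑ hw
    hb0 hϑ0 N Φ t (by simp only [sub_self]; exact integrable_const _)
    ((hsum.add (integrable_const _)).congr (hae.mono fun z hz => hz.symm))
  rw [klDiv_self, ENNReal.toReal_zero, sub_zero] at key
  rw [key, integral_congr_ae hae, integral_add hsum (integrable_const _), integral_const,
    probReal_univ, one_smul]

/-! ### §4 The registered stub `stub_windowEntropyBalance`, unfolded -/

/-- **R1 = `WindowEntropyBalance` of line `IdeatorOneSketch` (crux `HydroLimitInBand`,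
stmt-AtomisticToContinuum-9133) — step (i) of the entropy clock as an EXACT finite-`N` identity over one
window.** For the hard-sphere system on `𝕋³` at `0 < σ ≤ 1/2` started from the local Gibbs law
`λ_N = localGibbsLaw σ a₀ u₀ θ₀ N Φ`, a SMOOTH reference `ψ = (b, w, ϑ)` (used on `[s, s+h]`) and a continuous
reference `ψ′ = (b′, w′, ϑ′)` (used from `s + h` on), all profiles positive, `s, h ≥ 0`:
`KL(f_{s+h} ‖ ψ′_N) − KL(f_s ‖ ψ_N) = − E_{f_s}[∫₀ʰ G′_ψ(Φ_r z) dr + W^mom_{w/ϑ}(z,h) + W^en_{−1/ϑ}(z,h)]`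
`+ E_{f_{s+h}}[G_ψ − G_{ψ′}] + (log Z_pos(b′) − log Z_pos(b))`, `f_r = lawAt Φ λ_N r`: the two explicit
entropies `toReal_klDiv_lawAt_eq_integral` subtracted; the window term `E_λ[G_ψ(Φ_s z) − G_ψ(Φ_{s+h} z)]` is
transported to `f_s` (`Φ_{s+h} = Φ_h ∘ Φ_s` on the good set, which carries `λ_N` and `f_s`) and evaluated
pathwise by `oneBodySum_flow_sub_eq`; the switch term `E_λ[(G_ψ − G_{ψ′})(Φ_{s+h} z)]` is transported to
`f_{s+h}`. The statement is verbatim the body of the line's `WindowEntropyBalance`. [cite: Yau1991, §2] -/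
theorem windowEntropyBalance_identity :
  ∀ (σ : ℝ), 0 < σ → σ ≤ 1 / 2 →
  ∀ (a₀ θ₀ : T3 → ℝ) (u₀ : T3 → V3), Continuous a₀ → Continuous θ₀ → Continuous u₀ →
    (∀ x, 0 < a₀ x) → (∀ x, 0 < θ₀ x) →
  ∀ (b ϑ : T3 → ℝ) (w : T3 → V3), Literature.Analysis.FunctionSpaces.Torus.IsSmooth b →
    Literature.Analysis.FunctionSpaces.Torus.IsSmooth ϑ → Literature.Analysis.FunctionSpaces.Torus.IsSmooth w →
    (∀ x, 0 < b x) → (∀ x, 0 < ϑ x) →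
  ∀ (b' ϑ' : T3 → ℝ) (w' : T3 → V3), Continuous b' → Continuous ϑ' → Continuous w' →
    (∀ x, 0 < b' x) → (∀ x, 0 < ϑ' x) →
  ∀ (N : ℕ) (Φ : HardSphereFlow (Torus.geometry (Fin 3)) (hsDiameter σ N) (N + 1)) (s h : ℝ), 0 ≤ s → 0 ≤ h →
    (klDiv (Φ.lawAt (localGibbsLaw σ a₀ u₀ θ₀ N Φ) (s + h)) (localGibbsLaw σ b' w' ϑ' N Φ)).toReal -
        (klDiv (Φ.lawAt (localGibbsLaw σ a₀ u₀ θ₀ N Φ) s) (localGibbsLaw σ b w ϑ N Φ)).toReal =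
      -(∫ z, ((∫ r in (0 : ℝ)..h,
                ((∑ i, Literature.Analysis.FunctionSpaces.Torus.fderiv
                    (fun x => Real.log (b x) - 3 / 2 * Real.log (2 * Real.pi * ϑ x) - ‖w x‖ ^ 2 / (2 * ϑ x))
                    ((Φ.flow r z i).1) ((Φ.flow r z i).2)) +
                  momentumStreaming (fun x => (ϑ x)⁻¹ • w x) (Φ.flow r z) +
                  energyStreaming (fun x => -(ϑ x)⁻¹) (Φ.flow r z))) +
              Φ.momentumTransfer (fun x => (ϑ x)⁻¹ • w x) z h +
              Φ.energyTransfer (fun x => -(ϑ x)⁻¹) z h)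
          ∂(Φ.lawAt (localGibbsLaw σ a₀ u₀ θ₀ N Φ) s)) +
        (∫ z, ((∑ i, (Real.log (b (z i).1) - 3 / 2 * Real.log (2 * Real.pi * ϑ (z i).1) -
                  ‖(z i).2 - w (z i).1‖ ^ 2 / (2 * ϑ (z i).1))) -
              ∑ i, (Real.log (b' (z i).1) - 3 / 2 * Real.log (2 * Real.pi * ϑ' (z i).1) -
                  ‖(z i).2 - w' (z i).1‖ ^ 2 / (2 * ϑ' (z i).1)))
          ∂(Φ.lawAt (localGibbsLaw σ a₀ u₀ θ₀ N Φ) (s + h))) +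
        (Real.log (posPartition b' (hsDiameter σ N) (N + 1)) - Real.log (posPartition b (hsDiameter σ N) (N + 1))) := by
  intro σ _hσ hσ2 a₀ θ₀ u₀ ha hθ hu ha0 hθ0 b ϑ w hbs hϑs hws hb0 hϑ0 b' ϑ' w' hb' hϑ' hw' hb'0 hϑ'0
    N Φ s h _hs hh
  obtain ⟨hb, hϑ, hw⟩ : Continuous b ∧ Continuous ϑ ∧ Continuous w :=
    ⟨hbs.continuous, hϑs.continuous, hws.continuous⟩
  have hgood := ae_mem_good_localGibbsLaw σ a₀ θ₀ u₀ N Φ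
  -- the two explicit entropies and the integrable one-body sums
  have e1 := toReal_klDiv_lawAt_eq_integral hσ2 ha hθ hu ha0 hθ0 hb' hϑ' hw' hb'0 hϑ'0 N Φ (s + h)
  have e2 := toReal_klDiv_lawAt_eq_integral hσ2 ha hθ hu ha0 hθ0 hb hϑ hw hb0 hϑ0 N Φ s
  have hG0 := integrable_oneBodySum hσ2 ha hθ hu ha0 hθ0 ha hθ hu ha0 hθ0 N Φ
  have h1 := integrable_oneBodySum_flow hσ2 ha hθ hu ha0 hθ0 hb hϑ hw hb0 hϑ0 N Φ s
  have h2 := integrable_oneBodySum_flow hσ2 ha hθ hu ha0 hθ0 hb' hϑ' hw' hb'0 hϑ'0 N Φ (s + h)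
  have h3 := integrable_oneBodySum_flow hσ2 ha hθ hu ha0 hθ0 hb hϑ hw hb0 hϑ0 N Φ (s + h)
  -- (a) the window term, transported to `λ_N` and evaluated pathwise on the good set
  have hA : (∫ z, (∫ r in (0 : ℝ)..h,
          ((∑ i, Torus.fderiv
              (fun x => Real.log (b x) - 3 / 2 * Real.log (2 * Real.pi * ϑ x) - ‖w x‖ ^ 2 / (2 * ϑ x))
              ((Φ.flow r z i).1) ((Φ.flow r z i).2)) +
            momentumStreaming (fun x => (ϑ x)⁻¹ • w x) (Φ.flow r z) +
            energyStreaming (fun x => -(ϑ x)⁻¹) (Φ.flow r z))) +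
        Φ.momentumTransfer (fun x => (ϑ x)⁻¹ • w x) z h +
        Φ.energyTransfer (fun x => -(ϑ x)⁻¹) z h ∂(Φ.lawAt (localGibbsLaw σ a₀ u₀ θ₀ N Φ) s)) =
      ∫ z, ((∑ i, (Real.log (b (Φ.flow (s + h) z i).1) - 3 / 2 * Real.log (2 * Real.pi * ϑ (Φ.flow (s + h) z i).1) -
            ‖(Φ.flow (s + h) z i).2 - w (Φ.flow (s + h) z i).1‖ ^ 2 / (2 * ϑ (Φ.flow (s + h) z i).1))) -
          ∑ i, (Real.log (b (Φ.flow s z i).1) - 3 / 2 * Real.log (2 * Real.pi * ϑ (Φ.flow s z i).1) -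
            ‖(Φ.flow s z i).2 - w (Φ.flow s z i).1‖ ^ 2 / (2 * ϑ (Φ.flow s z i).1)))
        ∂(localGibbsLaw σ a₀ u₀ θ₀ N Φ) := by
    have hgood' : ∀ᵐ y ∂(Φ.lawAt (localGibbsLaw σ a₀ u₀ θ₀ N Φ) s), y ∈ Φ.good := by
      rw [HardSphereFlow.lawAt_eq]
      exact (ae_map_iff (Φ.measurable_flow s).aemeasurable Φ.measurableSet_good).2
        (hgood.mono fun z hz => Φ.mapsTo_good s hz)
    calc _ = ∫ y, ((∑ i, (Real.log (b (Φ.flow h y i).1) - 3 / 2 * Real.log (2 * Real.pi * ϑ (Φ.flow h y i).1) -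
              ‖(Φ.flow h y i).2 - w (Φ.flow h y i).1‖ ^ 2 / (2 * ϑ (Φ.flow h y i).1))) -
            ∑ i, (Real.log (b (y i).1) - 3 / 2 * Real.log (2 * Real.pi * ϑ (y i).1) -
              ‖(y i).2 - w (y i).1‖ ^ 2 / (2 * ϑ (y i).1)))
          ∂(Φ.lawAt (localGibbsLaw σ a₀ u₀ θ₀ N Φ) s) := by
          refine integral_congr_ae ?_
          filter_upwards [hgood'] with y hy
          exact (oneBodySum_flow_sub_eq Φ hbs hϑs hws hb0 hϑ0 hy hh).symm
      _ = ∫ z, ((∑ i, (Real.log (b (Φ.flow h (Φ.flow s z) i).1) -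
              3 / 2 * Real.log (2 * Real.pi * ϑ (Φ.flow h (Φ.flow s z) i).1) -
              ‖(Φ.flow h (Φ.flow s z) i).2 - w (Φ.flow h (Φ.flow s z) i).1‖ ^ 2 /
                (2 * ϑ (Φ.flow h (Φ.flow s z) i).1))) -
            ∑ i, (Real.log (b (Φ.flow s z i).1) - 3 / 2 * Real.log (2 * Real.pi * ϑ (Φ.flow s z i).1) -
              ‖(Φ.flow s z i).2 - w (Φ.flow s z i).1‖ ^ 2 / (2 * ϑ (Φ.flow s z i).1)))
          ∂(localGibbsLaw σ a₀ u₀ θ₀ N Φ) := by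
          rw [HardSphereFlow.lawAt_eq]
          exact integral_map (Φ.measurable_flow s).aemeasurable
            (((measurable_oneBodySum hb hϑ hw).comp (Φ.measurable_flow h)).sub
              (measurable_oneBodySum hb hϑ hw)).aestronglyMeasurable
      _ = _ := by
          refine integral_congr_ae ?_
          filter_upwards [hgood] with z hz
          rw [add_comm s h, Φ.flow_add h s z hz]
  -- (b) the reference switch at time `s + h`, transported to `λ_N`
  have hB : (∫ z, ((∑ i, (Real.log (b (z i).1) - 3 / 2 * Real.log (2 * Real.pi * ϑ (z i).1) -
          ‖(z i).2 - w (z i).1‖ ^ 2 / (2 * ϑ (z i).1))) -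
        ∑ i, (Real.log (b' (z i).1) - 3 / 2 * Real.log (2 * Real.pi * ϑ' (z i).1) -
          ‖(z i).2 - w' (z i).1‖ ^ 2 / (2 * ϑ' (z i).1)))
      ∂(Φ.lawAt (localGibbsLaw σ a₀ u₀ θ₀ N Φ) (s + h))) =
      ∫ z, ((∑ i, (Real.log (b (Φ.flow (s + h) z i).1) - 3 / 2 * Real.log (2 * Real.pi * ϑ (Φ.flow (s + h) z i).1) -
            ‖(Φ.flow (s + h) z i).2 - w (Φ.flow (s + h) z i).1‖ ^ 2 / (2 * ϑ (Φ.flow (s + h) z i).1))) -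
          ∑ i, (Real.log (b' (Φ.flow (s + h) z i).1) - 3 / 2 * Real.log (2 * Real.pi * ϑ' (Φ.flow (s + h) z i).1) -
            ‖(Φ.flow (s + h) z i).2 - w' (Φ.flow (s + h) z i).1‖ ^ 2 / (2 * ϑ' (Φ.flow (s + h) z i).1)))
        ∂(localGibbsLaw σ a₀ u₀ θ₀ N Φ) := by
    rw [HardSphereFlow.lawAt_eq]
    exact integral_map (Φ.measurable_flow _).aemeasurable
      ((measurable_oneBodySum hb hϑ hw).sub (measurable_oneBodySum hb' hϑ' hw')).aestronglyMeasurable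
  rw [e1, e2, hA, hB, integral_sub hG0 h2, integral_sub hG0 h1, integral_sub h3 h1, integral_sub h3 h2]
  ring

end Summit.AtomisticToContinuum.HydrodynamicLimit.Theorems.EntropyClockDock

end
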